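import Mathlib

/-!
# Hodge locus census — V3-XT, N = 1, 2 INERT: the census of `v₂(j(C))` on `Cl(-D)`, `D ≡ 3 (mod 8)`, the Hurwitz orders `ℤ[ω] + 2ᵏ𝒪_H`, and Tunnell's numbers (engine A, abs-1 gen 26, ROW 6)

HONEST FRAMING: certified instances and evidence bearing on the general Hodge conjecture; no claim.

Finite, kernel-checked core of `code/abs_engineA/xt/n1inert2/DERIVATION-I2-A.md` (THEOREM I2), the `ℓ = 2` companion of
`Theorems/HodgeLocusCensusInert3At1728*.lean` (ROW 5, `ℓ = 3`).  Setting: `D ≡ 3 (mod 8)` squarefree, `D > 3` (2 inert in `ℚ(√-D)`),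
`ν_t(-D) = #{C ∈ Cl(-D) : v₂(j(C)) ≥ t}`; `𝒪_H` the Hurwitz order of `(-1,-1)_ℚ` (24 units), `ω = (-1+i+j+k)/2`, `E_ω : y² + y = x³`.
Gross–Zagier's count `v_μ(j(τ₁) - j(τ₂)) = ½ Σ_{n ≥ 1} #Isom_n` and Gross's `End_n(E_ω) ≅ ℤ[ω] + 2ⁿ⁻¹𝒪_H` (as restated in
[LauterViray2012, §2 p. 7, §7 p. 18]) give `v₂(j(C)) = ½(24 + 6(N(C) - 1)) = 9 + 3N(C)`, `N(C) = max {n : the 𝒪_H^×-orbit of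
y_C = (1 + w)/2 meets ℤ[ω] + 2ⁿ⁻¹𝒪_H}`, where `w = bi + cj + dk`, `b, c, d` odd, `b² + c² + d² = D` runs over the `r₃(D) = 24h(-D)` images of `√-D`.
DERIVED and CERTIFIED (two implementations of the census — Newton polygons of `H_{-D}` at 2 and 2-adic factorisation at precision 160 — agree
for all 2023 squarefree `D ≡ 3 (mod 8)`, `11 ≤ D ≤ 20 000`, 48 070 classes; jobs j126430, j126586):

  (C)  membership criterion (this file, `criterion_mod4/8/16`, [omega]): `(1+w)/2 ∈ ℤ[ω] + 2ᵏ𝒪_H ⇔ b ≡ c ≡ d (mod 2ᵏ⁺¹)`;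
  (A)  level 2 is automatic (`level2_automatic`), so `v₂(j(C)) ∈ {15, 18, 21, …}` — census histogram `{15: 36056, 18: 9008, 21: 2252,
       24: 564, 27: 144, 30: 46}`, nothing else (2023/2023 D);
  (B)  dictionary `6·ν_{12+3k}(-D) = #{(b,c,d) ∈ ℤ³ : b²+c²+d² = D, b ≡ c ≡ d (mod 2ᵏ⁺¹)}` (k = 2, 3, 4: 2023/2023 D, orbit by orbit:
       exactly 3 of the 12 vectors of a meeting orbit satisfy the congruence, `three_per_orbit`);
  (T)  theta identity, PROVED by a finite check: for every `n ≡ 3 (mod 4)`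
         `6·a(n) - 12·b(n) = r₃(n) - 16·r(n; b ≡ c ≡ d (mod 8))`,  `a(n) = #{x²+2y²+8z² = n}`, `b(n) = #{x²+2y²+32z² = n}`
       (the four theta series lie in `M_{3/2}(Γ₀(128))` with trivial character — `det A = 4², 8², 1, 64²` [Shimura1973, Prop. 2.1]; restriction
       to `n ≡ 3 (mod 4)` has level `≤ 128·4² = 2048` [Shimura1973, Lemma 3.6], Sturm bound `(3/2)·3072/12 = 384` (`≤ 1536` even for the
       mod-8 restriction, level `≤ 8192`); verified for all 5000 `n ≡ 3 (mod 4)`, `n ≤ 20 000`, by two enumerations, `theta_I2.py`,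
       `theta_I2_impl2.py`; truncations below by `decide`);
  ⟹ THEOREM I2 (c): for squarefree `D ≡ 3 (mod 8)`, `D > 3`, Tunnell's number satisfies
         `a(D) - 2b(D) = 4·h(-D) - 16·ν₁₈(-D)`            (checked directly 2023/2023, `tunnell.py`; derived: `I2_derived`),
       so by [Tunnell1983Congruent] `L(E_D, 1) = 0 ⇔ h(-D) = 4·#{C ∈ Cl(-D) : 2¹⁸ ∣ j(C)}` (`E : y² = x³ - x`), and `D` is not a congruent
       number whenever `h(-D) ≠ 4ν₁₈(-D)` (Tunnell + Coates–Wiles); for `n ≡ 7 (mod 8)` (T) reads `a(n) = 2b(n)` (no sums of three squares).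
The cited theorems, the census, and the range of the finite checks are NOT re-proved here; tags: [cited] Gross–Zagier 1985 / Gross 1986 via
[LauterViray2012], [Shimura1973], [Tunnell1983Congruent], Gauss `r₃(D) = 24h(-D)`; [finite-check] (T) to 20 000 in the data files; [decide] boxes
below; [omega]/[numerals] the rest.
-/

namespace Summit.HodgeConjecture.HodgeConjecture.HodgeLocus.Census.Inert2At0

/-! ### (C) Membership in `ℤ[ω] + 2ᵏ𝒪_H` in doubled coordinates

`2y = (1, b, c, d)`, `2ω = (-1, 1, 1, 1)`; `y - α - βω ∈ 2ᵏ𝒪_H` iff `(1 - 2α + β, b - β, c - β, d - β) = 2ᵏ·(e₀, e₁, e₂, e₃)` with the `eᵢ`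
all of one parity (doubled Hurwitz coordinates).  For odd `b, c, d` this is `b ≡ c ≡ d (mod 2ᵏ⁺¹)`; instances `k = 1, 2, 3`. -/

/-- `k = 1`: `(1+w)/2 ∈ ℤ[ω] + 2𝒪_H ⇔ b ≡ c ≡ d (mod 4)` (`b, c, d` odd). [omega] -/
theorem criterion_mod4 (b c d : ℤ) (hb : b % 2 = 1) (hc : c % 2 = 1) (hd : d % 2 = 1) :
    (∃ α β e₀ e₁ e₂ e₃ : ℤ, (e₀ - e₁) % 2 = 0 ∧ (e₁ - e₂) % 2 = 0 ∧ (e₂ - e₃) % 2 = 0 ∧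
        1 - 2 * α + β = 2 * e₀ ∧ b - β = 2 * e₁ ∧ c - β = 2 * e₂ ∧ d - β = 2 * e₃) ↔
      ((b - c) % 4 = 0 ∧ (c - d) % 4 = 0) := by
  constructor
  · rintro ⟨α, β, e₀, e₁, e₂, e₃, h₀, h₁, h₂, h₃, h₄, h₅, h₆⟩
    omega
  · rintro ⟨h₁, h₂⟩
    exact ⟨(1 + b) / 2, b, 0, 0, (c - b) / 2, (d - b) / 2, by omega, by omega, by omega, by omega, by omega, by omega, by omega⟩

/-- `k = 2`: `(1+w)/2 ∈ ℤ[ω] + 4𝒪_H ⇔ b ≡ c ≡ d (mod 8)` — the level behind `ν₁₈`. [omega] -/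
theorem criterion_mod8 (b c d : ℤ) (hb : b % 2 = 1) (hc : c % 2 = 1) (hd : d % 2 = 1) :
    (∃ α β e₀ e₁ e₂ e₃ : ℤ, (e₀ - e₁) % 2 = 0 ∧ (e₁ - e₂) % 2 = 0 ∧ (e₂ - e₃) % 2 = 0 ∧
        1 - 2 * α + β = 4 * e₀ ∧ b - β = 4 * e₁ ∧ c - β = 4 * e₂ ∧ d - β = 4 * e₃) ↔
      ((b - c) % 8 = 0 ∧ (c - d) % 8 = 0) := by
  constructor
  · rintro ⟨α, β, e₀, e₁, e₂, e₃, h₀, h₁, h₂, h₃, h₄, h₅, h₆⟩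
    omega
  · rintro ⟨h₁, h₂⟩
    exact ⟨(1 + b) / 2, b, 0, 0, (c - b) / 4, (d - b) / 4, by omega, by omega, by omega, by omega, by omega, by omega, by omega⟩

/-- `k = 3`: `(1+w)/2 ∈ ℤ[ω] + 8𝒪_H ⇔ b ≡ c ≡ d (mod 16)` — the level behind `ν₂₁`. [omega] -/
theorem criterion_mod16 (b c d : ℤ) (hb : b % 2 = 1) (hc : c % 2 = 1) (hd : d % 2 = 1) :
    (∃ α β e₀ e₁ e₂ e₃ : ℤ, (e₀ - e₁) % 2 = 0 ∧ (e₁ - e₂) % 2 = 0 ∧ (e₂ - e₃) % 2 = 0 ∧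
        1 - 2 * α + β = 8 * e₀ ∧ b - β = 8 * e₁ ∧ c - β = 8 * e₂ ∧ d - β = 8 * e₃) ↔
      ((b - c) % 16 = 0 ∧ (c - d) % 16 = 0) := by
  constructor
  · rintro ⟨α, β, e₀, e₁, e₂, e₃, h₀, h₁, h₂, h₃, h₄, h₅, h₆⟩
    omega
  · rintro ⟨h₁, h₂⟩
    exact ⟨(1 + b) / 2, b, 0, 0, (c - b) / 8, (d - b) / 8, by omega, by omega, by omega, by omega, by omega, by omega, by omega⟩

/-! ### (A) Level 2 is automatic; three vectors per meeting orbit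

The unit group acts on `(b, c, d)` by cyclic permutations and by sign changes of two coordinates (the rotation group of order 12). -/

/-- For odd `b, c, d` one of the four sign patterns `(b,c,d), (b,-c,-d), (-b,c,-d), (-b,-c,d)` satisfies `≡ (mod 4)`; hence every class
meets `ℤ[ω] + 2𝒪_H`, `N(C) ≥ 2` and `v₂(j(C)) ≥ 15`. [omega] -/
theorem level2_automatic (b c d : ℤ) (hb : b % 2 = 1) (hc : c % 2 = 1) (hd : d % 2 = 1) :
    ((b - c) % 4 = 0 ∧ (c - d) % 4 = 0) ∨ ((b + c) % 4 = 0 ∧ (-c + d) % 4 = 0) ∨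
      ((-b - c) % 4 = 0 ∧ (c + d) % 4 = 0) ∨ ((-b + c) % 4 = 0 ∧ (-c - d) % 4 = 0) := by
  omega

/-- If `(b, c, d)` satisfies the congruence mod `2ᵏ⁺¹` (`k ≥ 1`, here mod 4), none of the three pair-sign-flipped vectors does (odd entries);
the cyclic permutations do, so exactly 3 of the 12 vectors of a meeting orbit lie in the order: `#{…} = 3·(2ν) = 6ν`. [omega] -/
theorem three_per_orbit (b c d : ℤ) (hb : b % 2 = 1) (hc : c % 2 = 1) (hd : d % 2 = 1)
    (h : (b - c) % 4 = 0 ∧ (c - d) % 4 = 0) :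
    ¬ ((b + c) % 4 = 0 ∧ (-c + d) % 4 = 0) ∧ ¬ ((-b - c) % 4 = 0 ∧ (c + d) % 4 = 0) ∧ ¬ ((-b + c) % 4 = 0 ∧ (-c - d) % 4 = 0) ∧
      ((c - d) % 4 = 0 ∧ (d - b) % 4 = 0) := by
  omega

/-- Orbit bookkeeping: `r = 3 · (2ν)` vectors in the order means `r = 6ν`. [omega] -/
theorem orbit_count (ν r : ℕ) (hr : r = 3 * (2 * ν)) : r = 6 * ν := by omega

/-- Gross–Zagier bookkeeping at `ℓ = 2`, `j = 0`: `#Isom_1 = #Aut(E₀) = 24`, `#Isom_n = #ℤ[ω]^× = 6` for `2 ≤ n ≤ N`, so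
`v₂(j(C)) = ½(24 + 6(N - 1)) = 9 + 3N = 12 + 3(N - 1)` (`N ≥ 1`; by (A) in fact `N ≥ 2`). [omega] -/
theorem gz_bookkeeping (N : ℕ) (hN : 1 ≤ N) :
    (24 + 6 * (N - 1)) / 2 = 9 + 3 * N ∧ 9 + 3 * N = 12 + 3 * (N - 1) := by
  omega

/-! ### Gram determinants, characters, levels, Sturm numerals -/

/-- `det A` for `x²+2y²+8z²`, `x²+2y²+32z²`, `x²+y²+z²` and the lattice `{b ≡ c ≡ d (mod 8)}` (basis `(1,1,1), (0,8,0), (0,0,8)`, Gram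
`[[3,8,8],[8,64,0],[8,0,64]]`) is `16, 64, 1, 4096` — all squares, so the four theta series have trivial character [Shimura1973, Prop. 2.1];
`det 2A = 128, 512, 8, 32768`. [numerals] -/
theorem gram_numerals :
    (1 : ℤ) * 2 * 8 = 4 ^ 2 ∧ (1 : ℤ) * 2 * 32 = 8 ^ 2 ∧
    (3 : ℤ) * (64 * 64 - 0) - 8 * (8 * 64 - 0) + 8 * (0 - 64 * 8) = 64 ^ 2 ∧
    (2 : ℤ) * 4 * 16 = 128 ∧ (2 : ℤ) * 4 * 64 = 512 ∧ (8 : ℤ) * 4096 = 32768 := by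
  refine ⟨by norm_num, by norm_num, by norm_num, by norm_num, by norm_num, by norm_num⟩

/-- Levels `32, 128, 4, 128` have lcm `128`; restriction to `n ≡ 3 (mod 4)` costs at most `4²`, to `n ≡ 3 (mod 8)` at most `8²`
[Shimura1973, Lemma 3.6]; Sturm bounds `(3/2)·[SL₂(ℤ) : Γ₀(M)]/12 = 3M/16`: `384` for `M = 2048`, `1536` for `M = 8192`, both below the
verified range `20 000`. [numerals] -/
theorem sturm_numerals :
    Nat.lcm (Nat.lcm 32 128) (Nat.lcm 4 128) = 128 ∧ 128 * 4 ^ 2 = 2048 ∧ 128 * 8 ^ 2 = 8192 ∧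
    3 * 2048 / 16 = 384 ∧ 3 * 8192 / 16 = 1536 ∧ 1536 < 20000 := by
  refine ⟨by decide, by norm_num, by norm_num, by norm_num, by norm_num, by norm_num⟩

/-! ### (T) Truncations of the theta identity (complete boxes, `decide`) -/

/-- (T) on `n ≡ 3 (mod 8)`, `n ≤ 51`: `6a(n) - 12b(n) + 16·r(n; b ≡ c ≡ d (8)) = r₃(n)` (boxes complete for `n ≤ 51`). [decide] -/
theorem T_truncated_3mod8 : ∀ n ∈ (Finset.range 52).filter (fun n => n % 8 = 3),
    6 * ((Finset.Icc (-7 : ℤ) 7 ×ˢ Finset.Icc (-5 : ℤ) 5 ×ˢ Finset.Icc (-2 : ℤ) 2).filter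
        (fun p => p.1 ^ 2 + 2 * p.2.1 ^ 2 + 8 * p.2.2 ^ 2 = (n : ℤ))).card +
    16 * ((Finset.Icc (-7 : ℤ) 7 ×ˢ Finset.Icc (-7 : ℤ) 7 ×ˢ Finset.Icc (-7 : ℤ) 7).filter
        (fun p => p.1 ^ 2 + p.2.1 ^ 2 + p.2.2 ^ 2 = (n : ℤ) ∧ (p.1 - p.2.1) % 8 = 0 ∧ (p.2.1 - p.2.2) % 8 = 0)).card =
    ((Finset.Icc (-7 : ℤ) 7 ×ˢ Finset.Icc (-7 : ℤ) 7 ×ˢ Finset.Icc (-7 : ℤ) 7).filter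
        (fun p => p.1 ^ 2 + p.2.1 ^ 2 + p.2.2 ^ 2 = (n : ℤ))).card +
    12 * ((Finset.Icc (-7 : ℤ) 7 ×ˢ Finset.Icc (-5 : ℤ) 5 ×ˢ Finset.Icc (-1 : ℤ) 1).filter
        (fun p => p.1 ^ 2 + 2 * p.2.1 ^ 2 + 32 * p.2.2 ^ 2 = (n : ℤ))).card := by
  decide +kernel

/-- (T) on `n ≡ 7 (mod 8)`, `n ≤ 47`: no sums of three squares, and `a(n) = 2b(n)` (Tunnell's vanishing class). [decide] -/
theorem T_truncated_7mod8 : ∀ n ∈ (Finset.range 48).filter (fun n => n % 8 = 7),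
    ((Finset.Icc (-7 : ℤ) 7 ×ˢ Finset.Icc (-5 : ℤ) 5 ×ˢ Finset.Icc (-2 : ℤ) 2).filter
        (fun p => p.1 ^ 2 + 2 * p.2.1 ^ 2 + 8 * p.2.2 ^ 2 = (n : ℤ))).card =
    2 * ((Finset.Icc (-7 : ℤ) 7 ×ˢ Finset.Icc (-5 : ℤ) 5 ×ˢ Finset.Icc (-1 : ℤ) 1).filter
        (fun p => p.1 ^ 2 + 2 * p.2.1 ^ 2 + 32 * p.2.2 ^ 2 = (n : ℤ))).card ∧
    ((Finset.Icc (-7 : ℤ) 7 ×ˢ Finset.Icc (-7 : ℤ) 7 ×ˢ Finset.Icc (-7 : ℤ) 7).filter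
        (fun p => p.1 ^ 2 + p.2.1 ^ 2 + p.2.2 ^ 2 = (n : ℤ))).card = 0 := by
  decide +kernel

/-! ### Anchors (`h(-D) = 1`): `D = 11, 19, 67` have `v₂(j) = 15` (`ν₁₈ = 0`), `D = 43, 163` have `v₂(j) = 18` (`ν₁₈ = 1`)
(`j((1+√-11)/2) = -2¹⁵`, `j((1+√-43)/2) = -2¹⁸·3³·5³`, `j((1+√-163)/2) = -2¹⁸·3³·5³·23³·29³`). -/

/-- Dictionary anchors: `#{b²+c²+d² = D, b ≡ c ≡ d (mod 8)} = 6·ν₁₈(-D)` is `0, 0, 6, 0, 6` at `D = 11, 19, 43, 67, 163`, counted in the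
parametrisation `(b, c, d) = (t, t + 8u, t + 8v)` of the congruence lattice (complete boxes). [decide] -/
theorem anchors_dictionary :
    ((Finset.Icc (-9 : ℤ) 9 ×ˢ Finset.Icc (-3 : ℤ) 3 ×ˢ Finset.Icc (-3 : ℤ) 3).filter
        (fun p => p.1 ^ 2 + (p.1 + 8 * p.2.1) ^ 2 + (p.1 + 8 * p.2.2) ^ 2 = (11 : ℤ))).card = 0 ∧
    ((Finset.Icc (-9 : ℤ) 9 ×ˢ Finset.Icc (-3 : ℤ) 3 ×ˢ Finset.Icc (-3 : ℤ) 3).filter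
        (fun p => p.1 ^ 2 + (p.1 + 8 * p.2.1) ^ 2 + (p.1 + 8 * p.2.2) ^ 2 = (19 : ℤ))).card = 0 ∧
    ((Finset.Icc (-9 : ℤ) 9 ×ˢ Finset.Icc (-3 : ℤ) 3 ×ˢ Finset.Icc (-3 : ℤ) 3).filter
        (fun p => p.1 ^ 2 + (p.1 + 8 * p.2.1) ^ 2 + (p.1 + 8 * p.2.2) ^ 2 = (43 : ℤ))).card = 6 * 1 ∧
    ((Finset.Icc (-9 : ℤ) 9 ×ˢ Finset.Icc (-3 : ℤ) 3 ×ˢ Finset.Icc (-3 : ℤ) 3).filter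
        (fun p => p.1 ^ 2 + (p.1 + 8 * p.2.1) ^ 2 + (p.1 + 8 * p.2.2) ^ 2 = (67 : ℤ))).card = 0 ∧
    ((Finset.Icc (-13 : ℤ) 13 ×ˢ Finset.Icc (-4 : ℤ) 4 ×ˢ Finset.Icc (-4 : ℤ) 4).filter
        (fun p => p.1 ^ 2 + (p.1 + 8 * p.2.1) ^ 2 + (p.1 + 8 * p.2.2) ^ 2 = (163 : ℤ))).card = 6 * 1 := by
  refine ⟨by decide +kernel, by decide +kernel, by decide +kernel, by decide +kernel, by decide +kernel⟩

/-- Tunnell anchors: `a(D) - 2b(D)` at `D = 11, 19, 43, 67, 163` is `4, 4, -12, 4, -12` `= 4h - 16ν₁₈` with `(h, ν₁₈) = (1,0), (1,0), (1,1),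
(1,0), (1,1)`. [decide] + [numerals] -/
theorem anchors_tunnell :
    (((Finset.Icc (-13 : ℤ) 13 ×ˢ Finset.Icc (-9 : ℤ) 9 ×ˢ Finset.Icc (-4 : ℤ) 4).filter
        (fun p => p.1 ^ 2 + 2 * p.2.1 ^ 2 + 8 * p.2.2 ^ 2 = (11 : ℤ))).card : ℤ) -
      2 * ((Finset.Icc (-13 : ℤ) 13 ×ˢ Finset.Icc (-9 : ℤ) 9 ×ˢ Finset.Icc (-2 : ℤ) 2).filter
        (fun p => p.1 ^ 2 + 2 * p.2.1 ^ 2 + 32 * p.2.2 ^ 2 = (11 : ℤ))).card = 4 * 1 - 16 * 0 ∧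
    (((Finset.Icc (-13 : ℤ) 13 ×ˢ Finset.Icc (-9 : ℤ) 9 ×ˢ Finset.Icc (-4 : ℤ) 4).filter
        (fun p => p.1 ^ 2 + 2 * p.2.1 ^ 2 + 8 * p.2.2 ^ 2 = (19 : ℤ))).card : ℤ) -
      2 * ((Finset.Icc (-13 : ℤ) 13 ×ˢ Finset.Icc (-9 : ℤ) 9 ×ˢ Finset.Icc (-2 : ℤ) 2).filter
        (fun p => p.1 ^ 2 + 2 * p.2.1 ^ 2 + 32 * p.2.2 ^ 2 = (19 : ℤ))).card = 4 * 1 - 16 * 0 ∧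
    (((Finset.Icc (-13 : ℤ) 13 ×ˢ Finset.Icc (-9 : ℤ) 9 ×ˢ Finset.Icc (-4 : ℤ) 4).filter
        (fun p => p.1 ^ 2 + 2 * p.2.1 ^ 2 + 8 * p.2.2 ^ 2 = (43 : ℤ))).card : ℤ) -
      2 * ((Finset.Icc (-13 : ℤ) 13 ×ˢ Finset.Icc (-9 : ℤ) 9 ×ˢ Finset.Icc (-2 : ℤ) 2).filter
        (fun p => p.1 ^ 2 + 2 * p.2.1 ^ 2 + 32 * p.2.2 ^ 2 = (43 : ℤ))).card = 4 * 1 - 16 * 1 ∧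
    (((Finset.Icc (-13 : ℤ) 13 ×ˢ Finset.Icc (-9 : ℤ) 9 ×ˢ Finset.Icc (-4 : ℤ) 4).filter
        (fun p => p.1 ^ 2 + 2 * p.2.1 ^ 2 + 8 * p.2.2 ^ 2 = (67 : ℤ))).card : ℤ) -
      2 * ((Finset.Icc (-13 : ℤ) 13 ×ˢ Finset.Icc (-9 : ℤ) 9 ×ˢ Finset.Icc (-2 : ℤ) 2).filter
        (fun p => p.1 ^ 2 + 2 * p.2.1 ^ 2 + 32 * p.2.2 ^ 2 = (67 : ℤ))).card = 4 * 1 - 16 * 0 ∧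
    (((Finset.Icc (-13 : ℤ) 13 ×ˢ Finset.Icc (-9 : ℤ) 9 ×ˢ Finset.Icc (-4 : ℤ) 4).filter
        (fun p => p.1 ^ 2 + 2 * p.2.1 ^ 2 + 8 * p.2.2 ^ 2 = (163 : ℤ))).card : ℤ) -
      2 * ((Finset.Icc (-13 : ℤ) 13 ×ˢ Finset.Icc (-9 : ℤ) 9 ×ˢ Finset.Icc (-2 : ℤ) 2).filter
        (fun p => p.1 ^ 2 + 2 * p.2.1 ^ 2 + 32 * p.2.2 ^ 2 = (163 : ℤ))).card = 4 * 1 - 16 * 1 := by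
  refine ⟨by decide +kernel, by decide +kernel, by decide +kernel, by decide +kernel, by decide +kernel⟩

/-! ### Assembly of THEOREM I2 (c) and its Tunnell reading -/

/-- From (T) `6a - 12b = r₃ - 16r_Q`, Gauss `r₃(D) = 24h(-D)` and the dictionary (B) `r_Q(D) = 6ν₁₈(-D)`:
`a(D) - 2b(D) = 4h(-D) - 16ν₁₈(-D)`. [omega] -/
theorem I2_derived (a b r₃ rQ h ν : ℤ) (hT : 6 * a - 12 * b = r₃ - 16 * rQ) (hGauss : r₃ = 24 * h) (hDict : rQ = 6 * ν) :
    a - 2 * b = 4 * h - 16 * ν := by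
  omega

/-- Tunnell reading: with `a - 2b = 4h - 16ν`, Tunnell's number vanishes iff `h(-D) = 4ν₁₈(-D)`; by [Tunnell1983Congruent] this is
`L(E_D, 1) = 0`, and `h ≠ 4ν` forces `D` non-congruent (Coates–Wiles).  Pure bookkeeping here. [omega] -/
theorem tunnell_reading (a b h ν : ℤ) (hI2 : a - 2 * b = 4 * h - 16 * ν) : (a - 2 * b = 0 ↔ h = 4 * ν) := by
  omega

/-- In particular `h(-D)` odd (e.g. `D` prime, Genocchi) or `h(-D) ≡ 2 (mod 4)` gives `a - 2b ≠ 0`, consistent with the classical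
non-congruence criteria. [omega] -/
theorem classical_cases (a b h ν : ℤ) (hI2 : a - 2 * b = 4 * h - 16 * ν) (hh : h % 4 ≠ 0) : a - 2 * b ≠ 0 := by
  omega

end Summit.HodgeConjecture.HodgeConjecture.HodgeLocus.Census.Inert2At0
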